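import Summits.CriticalPhenomena.PercolationContinuityZ3.Theorems.PercNearOneGluingNoHeavyLowerTailTwoLevelPackingCardSubTwoTransfer
import HarnessLib

/-!
# `NoHeavyLowerTail` (stmt-CriticalPhenomena-4575) — the FRAGMENTED-WORLD TRANSFER at EVERY level, with an arbitrary increasing guard

Support file (lemma factory #8 `prim-lf-8`, gen 5, batch 7; `--supports stmt-CriticalPhenomena-4575`).  No definitions, no named facts,
no sorries.  `μ = prodBernoulli w` on `Fin n`, relays `A`, observer `o`, level `j ≥ 1`, `N = |π(o)|`, `R_c = {|π(c)| ≤ j}`, `F = {o ↮ c}`,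
`D_c = {c ↮ A∖c}`, `U = ⋃_{b ∈ A∖c} {o ↔ b}`, and a GUARD `Q = {P(C_{A∖c})}` given by a monotone predicate `P` of the open edge
cluster of `A ∖ c` (e.g. "`A ∖ c` pairwise joined", or "some `j+1` relays of `A ∖ c` pairwise joined" = a heavy block exists);
reference world `W = D_c ∩ Q`.

* `fragmented_transfer_general` — **`μ((F ∩ {1 ≤ N} ∩ R_c) ∖ W) · μ(W) ≤ μ(R_c ∖ W) · μ(W ∩ U)`** for EVERY relay `c ∈ A`:
  "P(o attached off c | c light, outside W) ≤ P(o attached | W)".  The level-`(|A|−2)`, `Q = {A∖c joined}` instance is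
  `TwoLevelPackingCardSubTwo.fragmented_transfer`, the transfer behind STCS2/QP/QG at level `|A| − 2`
  (`…TwoLevelPackingCardSubTwo.lean`); this file removes the level restriction and frees the guard, for use in the fragmented
  decomposition (C4) at lower levels (`…FragmentedDecomposition.lean`; CANDIDATES.md v7 B7-9).
  Seat census of the two natural guards (exact, every relay c, cells (5,1)…(7,3)): 0 violations in 1 206 + 1 206 cases.

Proof: partition by the block `B = π(c)` (`real_eq_sum_blocks`); `B = {c}`: positive correlation of `U` and `Q` given `D_c`
(set-BHK, `AttachedChampionLevelOne.setCluster_upper_upper`); `2 ≤ |B| ≤ j`, `T = A ∖ B`: block/attachment exchange, cut exchange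
(`TwoLevelPackingCardSubTwo.blockEq_exchange`, `cut_exchange`), monotonicity, and the same positive correlation.
-/

noncomputable section

namespace Summit.CriticalPhenomena.PercolationContinuityZ3.Theorems

open MeasureTheory Set Filter Literature.Probability.LatticeModels Literature.Probability.Percolation
open scoped Classical BigOperators Topology

namespace FragmentedTransfer

open TwoLevelPackingCardSubTwo

variable {n : ℕ}

/-- **Positive correlation of `{o ↔ A∖c}` and an increasing guard of the cluster of `A ∖ c`, given `{c ↮ A∖c}`.**
[cite: VandenbergHaggstromKahn2005, Thm. 1.3 with Remark 1 (p. 5)] -/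
theorem touch_guard_posCorr (w : Sym2 (Fin n) → unitInterval) (S : Finset (Fin n)) (q o : Fin n)
    (P : Set (Sym2 (Fin n)) → Prop) (hP : ∀ ⦃C C' : Set (Sym2 (Fin n))⦄, C ⊆ C' → P C → P C') :
    (prodBernoulli w).real ({ω : BondConfig (Fin n) | ∀ t ∈ S, ω ∉ openConn q t} ∩ ⋃ b ∈ S, openConn o b) *
      (prodBernoulli w).real ({ω : BondConfig (Fin n) | ∀ t ∈ S, ω ∉ openConn q t} ∩
        {ω | P (⋃ s ∈ (↑S : Set (Fin n)), openEdgeCluster ω s)}) ≤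
    (prodBernoulli w).real {ω : BondConfig (Fin n) | ∀ t ∈ S, ω ∉ openConn q t} *
      (prodBernoulli w).real ({ω : BondConfig (Fin n) | ∀ t ∈ S, ω ∉ openConn q t} ∩
        ((⋃ b ∈ S, openConn o b) ∩ {ω | P (⋃ s ∈ (↑S : Set (Fin n)), openEdgeCluster ω s)})) := by
  set μ := prodBernoulli w with hμ
  set D : Set (BondConfig (Fin n)) := {ω | ∀ t ∈ S, ω ∉ openConn q t} with hD
  have hDeq : {ω : BondConfig (Fin n) | ∀ s ∈ (↑S : Set (Fin n)), ∀ t ∈ ({q} : Set (Fin n)),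
      ¬ (openGraph ω).Reachable s t} = D := by
    ext ω
    simp only [Set.mem_setOf_eq, Finset.mem_coe, Set.mem_singleton_iff, forall_eq, hD]
    refine forall₂_congr fun t ht => ?_
    change ¬ (openGraph ω).Reachable t q ↔ ¬ (openGraph ω).Reachable q t
    rw [SimpleGraph.reachable_comm]
  set U : Set (BondConfig (Fin n)) := ⋃ b ∈ S, openConn o b with hU
  have hUeq : {ω : BondConfig (Fin n) | o ∈ (↑S : Set (Fin n)) ∨
      ∃ e ∈ ⋃ s ∈ (↑S : Set (Fin n)), openEdgeCluster ω s, o ∈ e} = U := by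
    rw [TwoSetConditionalAssociation.setOf_mem_or_exists_mem_biUnion_openEdgeCluster]
    rw [hU]
    ext ω
    simp only [Set.mem_iUnion, Finset.mem_coe, exists_prop]
    refine exists_congr fun b => and_congr_right fun _ => ?_
    rw [KNPreFKG.openConn_symm]
  have key := AttachedChampionLevelOne.setCluster_upper_upper w (↑S : Set (Fin n)) ({q} : Set (Fin n))
    (fun C => o ∈ (↑S : Set (Fin n)) ∨ ∃ e ∈ C, o ∈ e) P
    (AttachedChampionLevelOne.touch_mono _ o) hP
  rw [hDeq] at key
  change μ.real (D ∩ {ω | o ∈ (↑S : Set (Fin n)) ∨ ∃ e ∈ ⋃ s ∈ (↑S : Set (Fin n)), openEdgeCluster ω s, o ∈ e}) *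
      μ.real (D ∩ {ω | P (⋃ s ∈ (↑S : Set (Fin n)), openEdgeCluster ω s)}) ≤
    μ.real D * μ.real (D ∩ ({ω | o ∈ (↑S : Set (Fin n)) ∨
        ∃ e ∈ ⋃ s ∈ (↑S : Set (Fin n)), openEdgeCluster ω s, o ∈ e} ∩
      {ω | P (⋃ s ∈ (↑S : Set (Fin n)), openEdgeCluster ω s)})) at key
  rw [hUeq] at key
  exact key

/-- **The per-block bound at every level with a guard.**  For `B ⊆ A`, `1 ≤ j`, `W = D_c ∩ Q`:
`μ(((F ∩ {1≤N} ∩ R_c) ∖ W) ∩ {π(c) = B}) · μ(W) ≤ μ((R_c ∖ W) ∩ {π(c) = B}) · μ(W ∩ U)`. [this work] -/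
theorem block_piece_le_general (w : Sym2 (Fin n) → unitInterval) (A : Finset (Fin n)) (o c : Fin n) (hc : c ∈ A)
    (j : ℕ) (hj : 1 ≤ j) (P : Set (Sym2 (Fin n)) → Prop) (hP : ∀ ⦃C C' : Set (Sym2 (Fin n))⦄, C ⊆ C' → P C → P C')
    (B : Finset (Fin n)) (hBA : B ⊆ A) :
    (prodBernoulli w).real ((((openConn o c : Set (BondConfig (Fin n)))ᶜ ∩
          {ω | 1 ≤ (A.filter fun x => ω ∈ openConn o x).card} ∩
          {ω | (A.filter fun x => ω ∈ openConn c x).card ≤ j}) \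
          ({ω : BondConfig (Fin n) | ∀ t ∈ A.erase c, ω ∉ openConn c t} ∩
            {ω | P (⋃ s ∈ (↑(A.erase c) : Set (Fin n)), openEdgeCluster ω s)})) ∩
        {ω | (A.filter fun z => ω ∈ openConn c z) = B}) *
      (prodBernoulli w).real ({ω : BondConfig (Fin n) | ∀ t ∈ A.erase c, ω ∉ openConn c t} ∩
        {ω | P (⋃ s ∈ (↑(A.erase c) : Set (Fin n)), openEdgeCluster ω s)}) ≤
    (prodBernoulli w).real (({ω : BondConfig (Fin n) | (A.filter fun x => ω ∈ openConn c x).card ≤ j} \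
          ({ω : BondConfig (Fin n) | ∀ t ∈ A.erase c, ω ∉ openConn c t} ∩
            {ω | P (⋃ s ∈ (↑(A.erase c) : Set (Fin n)), openEdgeCluster ω s)})) ∩
        {ω | (A.filter fun z => ω ∈ openConn c z) = B}) *
      (prodBernoulli w).real (({ω : BondConfig (Fin n) | ∀ t ∈ A.erase c, ω ∉ openConn c t} ∩
          {ω | P (⋃ s ∈ (↑(A.erase c) : Set (Fin n)), openEdgeCluster ω s)}) ∩
        ⋃ b ∈ A.erase c, (openConn o b : Set (BondConfig (Fin n)))) := by
  set μ := prodBernoulli w with hμ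
  set F : Set (BondConfig (Fin n)) := (openConn o c : Set (BondConfig (Fin n)))ᶜ with hF
  set N1 : Set (BondConfig (Fin n)) := {ω | 1 ≤ (A.filter fun x => ω ∈ openConn o x).card} with hN1
  set Rc : Set (BondConfig (Fin n)) := {ω | (A.filter fun x => ω ∈ openConn c x).card ≤ j} with hRc
  set Dc : Set (BondConfig (Fin n)) := {ω | ∀ t ∈ A.erase c, ω ∉ openConn c t} with hDc
  set Qg : Set (BondConfig (Fin n)) := {ω | P (⋃ s ∈ (↑(A.erase c) : Set (Fin n)), openEdgeCluster ω s)} with hQg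
  set U : Set (BondConfig (Fin n)) := ⋃ b ∈ A.erase c, (openConn o b : Set (BondConfig (Fin n))) with hU
  set Blk : Set (BondConfig (Fin n)) := {ω | (A.filter fun z => ω ∈ openConn c z) = B} with hBlk
  have hmeas : ∀ s : Set (BondConfig (Fin n)), MeasurableSet s := fun _ => MeasurableSet.of_discrete
  have hnn : ∀ s : Set (BondConfig (Fin n)), 0 ≤ μ.real s := fun _ => measureReal_nonneg
  have hmono : ∀ {s t : Set (BondConfig (Fin n))}, s ⊆ t → μ.real s ≤ μ.real t :=
    fun hst => measureReal_mono hst (measure_ne_top μ _)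
  have hpos : μ.real (Dc ∩ U) * μ.real (Dc ∩ Qg) ≤ μ.real Dc * μ.real (Dc ∩ (U ∩ Qg)) :=
    touch_guard_posCorr w (A.erase c) c o P hP
  by_cases hcB : c ∈ B
  swap
  · have hempty : ((F ∩ N1 ∩ Rc) \ (Dc ∩ Qg)) ∩ Blk = ∅ := by
      refine Set.eq_empty_iff_forall_notMem.2 fun ω hω => hcB ?_
      have h : (A.filter fun z => ω ∈ openConn c z) = B := hω.2
      rw [← h]; exact mem_block_self A hc ω
    rw [hempty, measureReal_empty, zero_mul]
    exact mul_nonneg (hnn _) (hnn _)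
  by_cases hB1 : B = {c}
  · -- `B = {c}`: the block event is `D_c`
    have hBlkD : Blk = Dc := by
      ext ω; rw [hBlk, mem_setOf_eq, hB1]; exact block_eq_singleton_iff A hc ω
    have hsub1 : ((F ∩ N1 ∩ Rc) \ (Dc ∩ Qg)) ∩ Blk ⊆ (Dc ∩ U) \ (Dc ∩ Qg) := by
      rintro ω ⟨⟨⟨⟨hoc, h1⟩, -⟩, hnW⟩, hD⟩
      rw [hBlkD] at hD
      obtain ⟨a, ha⟩ := Finset.card_pos.1 h1
      obtain ⟨haA, hoa⟩ := Finset.mem_filter.1 ha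
      have hac : a ≠ c := fun h => hoc (h ▸ hoa)
      exact ⟨⟨hD, mem_iUnion₂.2 ⟨a, Finset.mem_erase.2 ⟨hac, haA⟩, hoa⟩⟩, hnW⟩
    have hsub2 : Dc \ (Dc ∩ Qg) ⊆ (Rc \ (Dc ∩ Qg)) ∩ Blk := by
      rintro ω ⟨hD, hnW⟩
      rw [hBlkD]
      refine ⟨⟨?_, hnW⟩, hD⟩
      show (A.filter fun x => ω ∈ openConn c x).card ≤ j
      rw [(block_eq_singleton_iff A hc ω).2 hD, Finset.card_singleton]; exact hj
    have e1 : μ.real ((Dc ∩ U) \ (Dc ∩ Qg)) = μ.real (Dc ∩ U) - μ.real (Dc ∩ (U ∩ Qg)) := by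
      have h := measureReal_inter_add_sdiff (μ := μ) (s := Dc ∩ U) (t := Dc ∩ Qg) (hmeas _)
      have h' : Dc ∩ U ∩ (Dc ∩ Qg) = Dc ∩ (U ∩ Qg) := by
        ext ω; simp only [mem_inter_iff]; tauto
      rw [h'] at h; linarith
    have e2 : μ.real (Dc \ (Dc ∩ Qg)) = μ.real Dc - μ.real (Dc ∩ Qg) := by
      have h := measureReal_inter_add_sdiff (μ := μ) (s := Dc) (t := Dc ∩ Qg) (hmeas _)
      have h' : Dc ∩ (Dc ∩ Qg) = Dc ∩ Qg := by
        ext ω; simp only [mem_inter_iff]; tauto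
      rw [h'] at h; linarith
    have key : μ.real ((Dc ∩ U) \ (Dc ∩ Qg)) * μ.real (Dc ∩ Qg) ≤
        μ.real (Dc \ (Dc ∩ Qg)) * μ.real (Dc ∩ (U ∩ Qg)) := by
      rw [e1, e2]; nlinarith [hpos]
    have hWU : Dc ∩ (U ∩ Qg) = (Dc ∩ Qg) ∩ U := by
      ext ω; simp only [mem_inter_iff]; tauto
    calc μ.real (((F ∩ N1 ∩ Rc) \ (Dc ∩ Qg)) ∩ Blk) * μ.real (Dc ∩ Qg)
        ≤ μ.real ((Dc ∩ U) \ (Dc ∩ Qg)) * μ.real (Dc ∩ Qg) := mul_le_mul_of_nonneg_right (hmono hsub1) (hnn _)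
      _ ≤ μ.real (Dc \ (Dc ∩ Qg)) * μ.real (Dc ∩ (U ∩ Qg)) := key
      _ ≤ μ.real ((Rc \ (Dc ∩ Qg)) ∩ Blk) * μ.real ((Dc ∩ Qg) ∩ U) := by
          rw [← hWU]; exact mul_le_mul_of_nonneg_right (hmono hsub2) (hnn _)
  · -- `c ∈ B`, `B ≠ {c}`; `T = A ∖ B`
    set T : Finset (Fin n) := A \ B with hT
    set DT : Set (BondConfig (Fin n)) := {ω | ∀ t ∈ T, ω ∉ openConn c t} with hDT
    set OT : Set (BondConfig (Fin n)) := ⋃ t ∈ T, (openConn o t : Set (BondConfig (Fin n))) with hOT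
    set JB : Set (BondConfig (Fin n)) := {ω | ∀ b ∈ B, ω ∈ openConn c b} with hJB
    set CB : Set (BondConfig (Fin n)) := {ω | ∀ b ∈ B.erase c, ω ∉ openConn c b} with hCB
    have hBlk_eq : Blk = DT ∩ JB := by
      ext ω; exact blockEq_iff A B c hBA ω
    have hDc_eq : DT ∩ CB = Dc := by
      ext ω
      simp only [hDT, hCB, hDc, mem_inter_iff, mem_setOf_eq]
      constructor
      · rintro ⟨h1, h2⟩ t ht
        by_cases htB : t ∈ B
        · exact h2 t (Finset.mem_erase.2 ⟨(Finset.mem_erase.1 ht).1, htB⟩)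
        · exact h1 t (Finset.mem_sdiff.2 ⟨Finset.mem_of_mem_erase ht, htB⟩)
      · intro h
        refine ⟨fun t ht => h t (Finset.mem_erase.2 ⟨?_, (Finset.mem_sdiff.1 ht).1⟩),
          fun b hb => h b (Finset.mem_erase.2 ⟨(Finset.mem_erase.1 hb).1, hBA (Finset.mem_of_mem_erase hb)⟩)⟩
        rintro rfl; exact (Finset.mem_sdiff.1 ht).2 hcB
    have hOT_U : Dc ∩ OT ⊆ Dc ∩ U := by
      rintro ω ⟨hD, hO⟩
      obtain ⟨t, ht, hot⟩ := mem_iUnion₂.1 hO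
      refine ⟨hD, mem_iUnion₂.2 ⟨t, Finset.mem_erase.2 ⟨?_, (Finset.mem_sdiff.1 ht).1⟩, hot⟩⟩
      rintro rfl; exact (Finset.mem_sdiff.1 ht).2 hcB
    by_cases hBcard : j < B.card
    · have hempty : ((F ∩ N1 ∩ Rc) \ (Dc ∩ Qg)) ∩ Blk = ∅ := by
        refine Set.eq_empty_iff_forall_notMem.2 fun ω hω => ?_
        have hR : (A.filter fun x => ω ∈ openConn c x).card ≤ j := hω.1.1.2
        have hB : (A.filter fun z => ω ∈ openConn c z) = B := hω.2
        rw [hB] at hR; omega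
      rw [hempty, measureReal_empty, zero_mul]
      exact mul_nonneg (hnn _) (hnn _)
    · rw [not_lt] at hBcard
      have hsub1 : ((F ∩ N1 ∩ Rc) \ (Dc ∩ Qg)) ∩ Blk ⊆ DT ∩ (JB ∩ OT) := by
        rintro ω ⟨⟨⟨⟨hoc, h1⟩, -⟩, -⟩, hB⟩
        have hB' : ω ∈ DT ∩ JB := hBlk_eq ▸ hB
        refine ⟨hB'.1, hB'.2, ?_⟩
        obtain ⟨a, ha⟩ := Finset.card_pos.1 h1
        obtain ⟨haA, hoa⟩ := Finset.mem_filter.1 ha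
        have haB : a ∉ B := by
          intro haB
          have hca : (openGraph ω).Reachable c a := hB'.2 a haB
          exact hoc ((show (openGraph ω).Reachable o a from hoa).trans hca.symm)
        exact mem_iUnion₂.2 ⟨a, Finset.mem_sdiff.2 ⟨haA, haB⟩, hoa⟩
      have hsub2 : DT ∩ JB ⊆ (Rc \ (Dc ∩ Qg)) ∩ Blk := by
        intro ω hω
        have hB : ω ∈ Blk := hBlk_eq ▸ hω
        have hB' : (A.filter fun z => ω ∈ openConn c z) = B := hB
        refine ⟨⟨?_, ?_⟩, hB⟩
        · show (A.filter fun x => ω ∈ openConn c x).card ≤ j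
          rw [hB']; exact hBcard
        · rintro ⟨hD, -⟩
          have : (A.filter fun z => ω ∈ openConn c z) = {c} := (block_eq_singleton_iff A hc ω).2 hD
          exact hB1 (hB'.symm.trans this)
      have h1 : μ.real (DT ∩ (JB ∩ OT)) * μ.real DT ≤ μ.real (DT ∩ JB) * μ.real (DT ∩ OT) :=
        blockEq_exchange w B T o c
      have h2 : μ.real (DT ∩ OT) * μ.real (DT ∩ CB) ≤ μ.real DT * μ.real (DT ∩ (CB ∩ OT)) :=
        cut_exchange w (B.erase c) T o c
      have h2' : μ.real (DT ∩ OT) * μ.real Dc ≤ μ.real DT * μ.real (Dc ∩ OT) := by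
        rw [← hDc_eq, Set.inter_assoc]; exact h2
      have h3 : μ.real (Dc ∩ OT) * μ.real (Dc ∩ Qg) ≤ μ.real Dc * μ.real (Dc ∩ (U ∩ Qg)) :=
        (mul_le_mul_of_nonneg_right (hmono hOT_U) (hnn _)).trans hpos
      have key : μ.real (DT ∩ (JB ∩ OT)) * μ.real (Dc ∩ Qg) ≤ μ.real (DT ∩ JB) * μ.real (Dc ∩ (U ∩ Qg)) :=
        chain_cancel (hnn _) (hnn _) (hnn _) (hnn _) (hnn _) (hnn _) (hnn _) (hnn _)
          (hmono fun ω hω => ⟨hω.1, hω.2.1⟩) (hmono Set.inter_subset_left) (hmono Set.inter_subset_left) h1 h2' h3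
      have hWU : Dc ∩ (U ∩ Qg) = (Dc ∩ Qg) ∩ U := by
        ext ω; simp only [mem_inter_iff]; tauto
      calc μ.real (((F ∩ N1 ∩ Rc) \ (Dc ∩ Qg)) ∩ Blk) * μ.real (Dc ∩ Qg)
          ≤ μ.real (DT ∩ (JB ∩ OT)) * μ.real (Dc ∩ Qg) := mul_le_mul_of_nonneg_right (hmono hsub1) (hnn _)
        _ ≤ μ.real (DT ∩ JB) * μ.real (Dc ∩ (U ∩ Qg)) := key
        _ ≤ μ.real ((Rc \ (Dc ∩ Qg)) ∩ Blk) * μ.real ((Dc ∩ Qg) ∩ U) := by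
            rw [← hWU]; exact mul_le_mul_of_nonneg_right (hmono hsub2) (hnn _)

/-- **The fragmented-world transfer at every level, every relay, every increasing guard.**  With `W = D_c ∩ Q`:
`μ((F ∩ {1 ≤ N} ∩ R_c) ∖ W) · μ(W) ≤ μ(R_c ∖ W) · μ(W ∩ U)`. [this work] -/
theorem fragmented_transfer_general (w : Sym2 (Fin n) → unitInterval) (A : Finset (Fin n)) (o c : Fin n)
    (hc : c ∈ A) (j : ℕ) (hj : 1 ≤ j)
    (P : Set (Sym2 (Fin n)) → Prop) (hP : ∀ ⦃C C' : Set (Sym2 (Fin n))⦄, C ⊆ C' → P C → P C') :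
    (prodBernoulli w).real (((openConn o c : Set (BondConfig (Fin n)))ᶜ ∩
          {ω | 1 ≤ (A.filter fun x => ω ∈ openConn o x).card} ∩
          {ω | (A.filter fun x => ω ∈ openConn c x).card ≤ j}) \
          ({ω : BondConfig (Fin n) | ∀ t ∈ A.erase c, ω ∉ openConn c t} ∩
            {ω | P (⋃ s ∈ (↑(A.erase c) : Set (Fin n)), openEdgeCluster ω s)})) *
      (prodBernoulli w).real ({ω : BondConfig (Fin n) | ∀ t ∈ A.erase c, ω ∉ openConn c t} ∩
        {ω | P (⋃ s ∈ (↑(A.erase c) : Set (Fin n)), openEdgeCluster ω s)}) ≤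
    (prodBernoulli w).real ({ω : BondConfig (Fin n) | (A.filter fun x => ω ∈ openConn c x).card ≤ j} \
          ({ω : BondConfig (Fin n) | ∀ t ∈ A.erase c, ω ∉ openConn c t} ∩
            {ω | P (⋃ s ∈ (↑(A.erase c) : Set (Fin n)), openEdgeCluster ω s)})) *
      (prodBernoulli w).real (({ω : BondConfig (Fin n) | ∀ t ∈ A.erase c, ω ∉ openConn c t} ∩
          {ω | P (⋃ s ∈ (↑(A.erase c) : Set (Fin n)), openEdgeCluster ω s)}) ∩
        ⋃ b ∈ A.erase c, (openConn o b : Set (BondConfig (Fin n)))) := by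
  rw [real_eq_sum_blocks w A c ((((openConn o c : Set (BondConfig (Fin n)))ᶜ ∩ _ ∩ _) \ _)),
    real_eq_sum_blocks w A c ({ω : BondConfig (Fin n) | (A.filter fun x => ω ∈ openConn c x).card ≤ j} \ _),
    Finset.sum_mul, Finset.sum_mul]
  exact Finset.sum_le_sum fun B hB => block_piece_le_general w A o c hc j hj P hP B (Finset.mem_powerset.1 hB)

end FragmentedTransfer

end Summit.CriticalPhenomena.PercolationContinuityZ3.Theorems

end
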